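import Summits.QuantumFields.BalabanUV.InfiniteVolume.LoopProductGrid

/-!
# `InfiniteVolume.LoopProductVanishing` — infinite volume, what would suffice (lineage IR-1, module XXV, part 2 of 3):
# the product classes `𝒫_k`, the vanishing lemma, the loaded edges and the witness observable

HONEST FRAMING (cell `pub-balaban`, soloist seat IR-1, generation 24; tree target `Summits/QuantumFields/BalabanUV/InfiniteVolume/`
under the LEAN PLACEMENT RULE 2026-08-19).  Part 2 of module XXV (part 1 = `LoopProductGrid`, part 3 = `LoopProductThreshold`,
which carries the thesis and the census consequence).  Elementary and kernel-checked; NOT a statement about Bałaban's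
renormalisation group, NOT infinite-volume existence, NOT the continuum, NOT Clay; NOT summit progress.

ABSOLUTE RULE.  No internally-minted statement may enter as a cited fact.  Every hypothesis is either kernel-proved in this
package or a verbatim quotation of a PUBLISHED theorem with page reference.  The manuscript(s) under audit are NOT citable for
their own disputed steps — they are the thing under adjudication; programme-internal (2001/route/tribunal) claims are never
citable.  In this file NOTHING printed is used as a hypothesis and nothing is cited: every statement is proved from Mathlib and
from the tree's definitions (`LatticeGaugeDLR`, `WilsonLoops`, `GaugeGroupsProofs`, modules XIX, XXII–XXIV of the lineage),
imported BY NAME and not modified.  `[folklore]` throughout.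

WHAT THIS PART PROVES.
* PART D — the classes `𝒫_k` (`allProdLoopObs`: products `U ↦ Π_{i<k} f_i(U_{ℓ_i})` of EXACTLY `k` single-loop observables,
  `f_i : G → ℝ` arbitrary, `ℓ_i` arbitrary based closed walks of `ℤ^d`) and `𝒫_{≤k}` (`allProdLoopObsLE`); module XXIV's
  class `𝒲_all` of all single-loop observables is contained in `𝒫_1` (`allSingleLoopObs_subset_allProdLoopObs_one`).
* PART E — THE VANISHING LEMMA (`sum_zchar_trZ_mul_eq_zero`): with `A = (ℤ/q)^p`, `s ∈ (ℤ/q)^{p×p}`, the weights `χ(tr s)`,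
  `tr s = Σ_j s_jj` (`trZ`), and `k` integer linear forms `M s` (`linRows`): for `k < p` pigeonhole (`q^k < q^p`,
  `exists_ne_zero_kernel_vec`) gives `κ ≠ 0` with `M κ = 0`; a column shift `u₀` with `M u₀ = 0`, `tr u₀ ≠ 0` (`exists_shift`)
  and part 1's shift lemma give `Σ_s χ(tr s) φ(M s) = 0` for EVERY `φ` (real form `sum_re_zchar_trZ_mul_eq_zero`).
* PART F₁ — the concrete geometry on `ℤ^{d+2}`: loaded edges `E_j = (2j·e₁; direction 0)` (`loadedEdge`), test plaquettes
  `p_j = (2j·e₁; e₀, e₁)` whose only loaded edge is `E_j`, so `(U_s)_{p_j} = D(s_j)` (`plaquetteHolonomyZd_gridCfg`); the real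
  fundamental character `Re tr` (the tree's `reTr`, a continuous class function) and the witness `F = Π_{j<p} Re tr U_{p_j}` (`witnessObs`):
  a member of `𝒫_p` (`witnessObs_mem_allProdLoopObs`, via the tree's `walkHolonomy_rectWalk_one_one`), gauge invariant, a
  cylinder, continuous, bounded.

VERSIONS: v1 (gen 24).
-/

namespace Summit.QuantumFields.BalabanUV.InfiniteVolume.LoopProductVanishing

open Literature.MathematicalPhysics.QuantumFieldTheory hiding ZdEdge
open Literature.MathematicalPhysics.QuantumLattice
open Literature.Probability.LatticeModels (zdGraph)
open Summit.QuantumFields.BalabanUV.InfiniteVolume.LoopProductGrid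

/-! ## PART D — THE CLASSES `𝒫_k`, `𝒫_{≤k}` OF PRODUCTS OF SINGLE-LOOP OBSERVABLES IN ARBITRARY FUNCTIONS -/

section ProdObs

variable {d : ℕ} {G : Type*} [Group G] {k : ℕ}

/-- `U ↦ Π_{i<k} f_i(hol_{ℓ_i}(U))` for `k` functions `f_i : G → ℝ` and `k` closed lattice walks `ℓ_i`. [folklore] -/
noncomputable def prodLoopObs (f : Fin k → G → ℝ) (ℓ : Fin k → Σ x : (Fin d → ℤ), (zdGraph d).Walk x x)
    (U : LGConfig d G) : ℝ :=
  ∏ i, wilsonLoopObs (f i) (ℓ i).2 U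

/-- THE CLASS `𝒫_k(G, d)` of all products of EXACTLY `k` single-loop observables `U ↦ f(hol_ℓ U)`, `f : G → ℝ`
ARBITRARY (not necessarily continuous, not necessarily a class function), `ℓ` an arbitrary based closed walk in `ℤ^d`
(`k = 0`: the constant `1`). [folklore] -/
def allProdLoopObs (d : ℕ) (G : Type*) [Group G] (k : ℕ) : Set (LGConfig d G → ℝ) :=
  Set.range (fun P : (Fin k → G → ℝ) × (Fin k → Σ x : (Fin d → ℤ), (zdGraph d).Walk x x) => prodLoopObs P.1 P.2)

/-- THE CLASS `𝒫_{≤k} = ⋃_{j ≤ k} 𝒫_j` of products of AT MOST `k` single-loop observables. [folklore] -/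
def allProdLoopObsLE (d : ℕ) (G : Type*) [Group G] (k : ℕ) : Set (LGConfig d G → ℝ) :=
  {W | ∃ j ≤ k, W ∈ allProdLoopObs d G j}

/-- Membership, definitionally. [folklore] -/
theorem prodLoopObs_mem_allProdLoopObs (f : Fin k → G → ℝ) (ℓ : Fin k → Σ x : (Fin d → ℤ), (zdGraph d).Walk x x) :
    prodLoopObs f ℓ ∈ allProdLoopObs d G k := ⟨(f, ℓ), rfl⟩

/-- `𝒫_j ⊆ 𝒫_{≤k}` for `j ≤ k`. [folklore] -/
theorem allProdLoopObs_subset_allProdLoopObsLE {j : ℕ} (hj : j ≤ k) :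
    allProdLoopObs d G j ⊆ allProdLoopObsLE d G k :=
  fun _ hW => ⟨j, hj, hW⟩

/-- `𝒫_{≤j} ⊆ 𝒫_{≤k}` for `j ≤ k`. [folklore] -/
theorem allProdLoopObsLE_mono {j : ℕ} (hj : j ≤ k) : allProdLoopObsLE d G j ⊆ allProdLoopObsLE d G k :=
  fun _ ⟨i, hi, hW⟩ => ⟨i, hi.trans hj, hW⟩

/-- A single-loop observable is a product of one factor: `𝒲_all ⊆ 𝒫_1`. [folklore] -/
theorem wilsonLoopObs_mem_allProdLoopObs_one (f : G → ℝ) {x : Fin d → ℤ} (ℓ : (zdGraph d).Walk x x) :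
    wilsonLoopObs f ℓ ∈ allProdLoopObs d G 1 := by
  refine ⟨(fun _ => f, fun _ => ⟨x, ℓ⟩), ?_⟩
  funext U
  simp [prodLoopObs]

/-- Module XXIV's class `𝒲_all` of ALL single-loop observables for `SU(n+3)` is contained in `𝒫_1`. [folklore] -/
theorem allSingleLoopObs_subset_allProdLoopObs_one (d n : ℕ) :
    allSingleLoopObs d n ⊆ allProdLoopObs (d + 2) (Matrix.specialUnitaryGroup (Fin (n + 3)) ℂ) 1 := by
  rintro W ⟨⟨f, ℓ⟩, rfl⟩
  exact wilsonLoopObs_mem_allProdLoopObs_one f ℓ.2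

end ProdObs

/-! ## PART E — THE VANISHING LEMMA: FOR `k < p` THE WEIGHTS `χ(tr s)` KILL EVERY FUNCTION OF `k` LINEAR FORMS -/

section Vanishing

variable {q : ℕ} {p k : ℕ}

/-- The `k` linear forms `(M s)_i = Σ_j M_{ij} • s_j` in `p` variables `s_j ∈ A`. [folklore] -/
def linRows {A : Type*} [AddCommGroup A] (M : Fin k → Fin p → ℤ) (s : Fin p → A) : Fin k → A :=
  fun i => ∑ j, M i j • s j

/-- `M (s + u) = M s + M u`. [folklore] -/
theorem linRows_add {A : Type*} [AddCommGroup A] (M : Fin k → Fin p → ℤ) (s u : Fin p → A) :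
    linRows M (s + u) = linRows M s + linRows M u := by
  funext i
  simp only [linRows, Pi.add_apply, zsmul_add, Finset.sum_add_distrib]

/-- Coordinates: for rows in `A = (ℤ/q)^p`, `(M s)_i(l) = Σ_j M_{ij} s_j(l)`. [folklore] -/
theorem linRows_apply (M : Fin k → Fin p → ℤ) (s : Fin p → Fin p → ZMod q) (i : Fin k) (l : Fin p) :
    linRows M s i l = ∑ j, (M i j : ZMod q) * s j l := by
  show (∑ j, M i j • s j) l = _
  rw [Finset.sum_apply]
  refine Finset.sum_congr rfl fun j _ => ?_
  show M i j • s j l = _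
  rw [zsmul_eq_mul]

/-- The "trace" `tr s = Σ_j s_j(j)` of a square array `s ∈ (ℤ/q)^{p × p}` (row `j` = the torsion coordinates on the
loaded edge `E_j`). [folklore] -/
def trZ (s : Fin p → Fin p → ZMod q) : ZMod q := ∑ j, s j j

/-- `tr` is additive. [folklore] -/
theorem trZ_add (s u : Fin p → Fin p → ZMod q) : trZ (s + u) = trZ s + trZ u := by
  simp only [trZ, Pi.add_apply, Finset.sum_add_distrib]

variable [NeZero q]

/-- **Pigeonhole kernel vector.**  For `k < p` and `q ≥ 2` every integer `k × p` matrix `M` has a NON-ZERO vector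
`κ ∈ (ℤ/q)^p` with `M κ = 0 (mod q)`: the additive map `(ℤ/q)^p → (ℤ/q)^k` cannot be injective since `q^p > q^k`
(no field structure on `ℤ/q` is needed). [folklore] -/
theorem exists_ne_zero_kernel_vec (hq : 1 < q) (hk : k < p) (M : Fin k → Fin p → ℤ) :
    ∃ κ : Fin p → ZMod q, κ ≠ 0 ∧ ∀ i, ∑ j, (M i j : ZMod q) * κ j = 0 := by
  set T : (Fin p → ZMod q) → (Fin k → ZMod q) := fun κ i => ∑ j, (M i j : ZMod q) * κ j with hT
  have hcard : Fintype.card (Fin k → ZMod q) < Fintype.card (Fin p → ZMod q) := by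
    simp only [Fintype.card_fun, ZMod.card, Fintype.card_fin]
    exact Nat.pow_lt_pow_right hq hk
  have hni : ¬ Function.Injective T := fun hinj => absurd (Fintype.card_le_of_injective T hinj) (not_le.2 hcard)
  obtain ⟨a, b, hab, hne⟩ := Function.not_injective_iff.1 hni
  refine ⟨a - b, sub_ne_zero.2 hne, fun i => ?_⟩
  have h := congrFun hab i
  simp only [hT] at h
  simp only [Pi.sub_apply, mul_sub, Finset.sum_sub_distrib, h, sub_self]

/-- **The shift.**  For `k < p` there is `u₀ ∈ (ℤ/q)^{p×p}` with `M u₀ = 0` and `tr u₀ ≠ 0`: put a kernel vector `κ`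
(`κ_l ≠ 0`) into column `l`. [folklore] -/
theorem exists_shift (hq : 1 < q) (hk : k < p) (M : Fin k → Fin p → ℤ) :
    ∃ u₀ : Fin p → Fin p → ZMod q, linRows M u₀ = 0 ∧ trZ u₀ ≠ 0 := by
  obtain ⟨κ, hκ0, hκ⟩ := exists_ne_zero_kernel_vec hq hk M
  obtain ⟨l, hl⟩ : ∃ l, κ l ≠ 0 := Function.ne_iff.1 hκ0
  refine ⟨fun j j' => if j' = l then κ j else 0, ?_, ?_⟩
  · funext i j'
    rw [linRows_apply, Pi.zero_apply, Pi.zero_apply]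
    by_cases h : j' = l
    · simp only [h, if_true]; exact hκ i
    · simp [h]
  · simpa [trZ] using hl

/-- **THE VANISHING LEMMA (complex form).**  For `k < p`, `q ≥ 2`, any integer `k × p` matrix `M` and ANY function
`φ` of `k` row-vectors: `Σ_{s ∈ (ℤ/q)^{p×p}} χ(tr s) · φ(M s) = 0`. [folklore] -/
theorem sum_zchar_trZ_mul_eq_zero (hq : 1 < q) (hk : k < p) (M : Fin k → Fin p → ℤ)
    (φ : (Fin k → Fin p → ZMod q) → ℂ) : ∑ s : Fin p → Fin p → ZMod q, zchar q (trZ s) * φ (linRows M s) = 0 := by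
  obtain ⟨u₀, hu₀, htr⟩ := exists_shift hq hk M
  exact sum_zchar_mul_eq_zero_of_shift trZ trZ_add (fun s => φ (linRows M s)) u₀
    (fun s => by simp only [linRows_add, hu₀, add_zero]) htr

/-- **THE VANISHING LEMMA (real form)**, with the real weights `v_s = Re χ(tr s)` and a real `φ`. [folklore] -/
theorem sum_re_zchar_trZ_mul_eq_zero (hq : 1 < q) (hk : k < p) (M : Fin k → Fin p → ℤ)
    (φ : (Fin k → Fin p → ZMod q) → ℝ) :
    ∑ s : Fin p → Fin p → ZMod q, (zchar q (trZ s)).re * φ (linRows M s) = 0 := by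
  have h := congrArg Complex.re (sum_zchar_trZ_mul_eq_zero hq hk M (fun t => (φ t : ℂ)))
  rw [Complex.re_sum, Complex.zero_re] at h
  simpa only [Complex.re_mul_ofReal] using h

end Vanishing

/-! ## PART F₁ — THE CONCRETE GEOMETRY ON `ℤ^{d+2}`: `p` LOADED EDGES, THE TEST PLAQUETTES, THE WITNESS `F` -/

section Concrete

variable {d p q : ℕ}

/-- THE LOADED EDGES `E_j = (2j·e₁; direction 0)`, `j < p`, of `ℤ^{d+2}`. [folklore] -/
def loadedEdge (d p : ℕ) (j : Fin p) : ZdEdge (d + 2) := (Pi.single 1 (2 * ((j : ℕ) : ℤ)), 0)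

/-- THE BASE POINTS `x_j = 2j·e₁` of the test plaquettes `p_j = (x_j; e₀, e₁)` (whose first edge is `E_j`).
[folklore] -/
def plaqSite (d p : ℕ) (j : Fin p) : Fin (d + 2) → ℤ := Pi.single 1 (2 * ((j : ℕ) : ℤ))

/-- `E_j` read against `E_{j'}`: `[j = j']`. [folklore] -/
theorem edgeCoeff_loadedEdge_loadedEdge (j j' : Fin p) :
    edgeCoeff (loadedEdge d p j') (loadedEdge d p j) = if j = j' then 1 else 0 := by
  unfold edgeCoeff loadedEdge
  by_cases h : j = j'
  · simp [h]
  · rw [if_neg, if_neg h]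
    intro heq
    have h1 := congrFun (congrArg Prod.fst heq) 1
    simp only [Pi.single_eq_same] at h1
    exact h (Fin.ext (by omega))

/-- Edges in direction `1` are never loaded. [folklore] -/
theorem edgeCoeff_loadedEdge_dir_one (j' : Fin p) (x : Fin (d + 2) → ℤ) :
    edgeCoeff (loadedEdge d p j') (x, 1) = 0 := by
  unfold edgeCoeff loadedEdge
  rw [if_neg]
  intro heq
  have h := congrArg Prod.snd heq
  exact absurd (Fin.ext_iff.1 h) (by simp)

/-- The top edge `(x_j + e₁; 0)` of the plaquette `p_j` is not loaded (`2j + 1 ≠ 2j'`). [folklore] -/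
theorem edgeCoeff_loadedEdge_top (j j' : Fin p) :
    edgeCoeff (loadedEdge d p j') (plaqSite d p j + Pi.single 1 1, 0) = 0 := by
  unfold edgeCoeff loadedEdge plaqSite
  rw [if_neg]
  intro heq
  have h1 := congrFun (congrArg Prod.fst heq) 1
  simp only [Pi.add_apply, Pi.single_eq_same] at h1
  omega

section AnyGroup

variable {G : Type*} [Group G] {A : Type*} [AddCommGroup A] {D : A → G}

omit [Group G] in
/-- `U_s(E_j) = D(s_j)`. [folklore] -/
theorem gridCfg_loadedEdge (s : Fin p → A) (j : Fin p) :
    gridCfg (loadedEdge d p) D s (loadedEdge d p j) = D (s j) := by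
  unfold gridCfg
  congr 1
  rw [Finset.sum_eq_single j]
  · rw [edgeCoeff_loadedEdge_loadedEdge, if_pos rfl, one_zsmul]
  · intro j' _ hj'
    rw [edgeCoeff_loadedEdge_loadedEdge, if_neg (Ne.symm hj'), zero_zsmul]
  · intro h
    exact absurd (Finset.mem_univ j) h

/-- **The test plaquette `p_j` reads the `j`-th variable: `(U_s)_{p_j} = D(s_j)`** (its other three edges are not
loaded). [folklore] -/
theorem plaquetteHolonomyZd_gridCfg (hD : ∀ a b, D (a + b) = D a * D b) (s : Fin p → A) (j : Fin p) :
    plaquetteHolonomyZd (gridCfg (loadedEdge d p) D s) (plaqSite d p j) 0 1 = D (s j) := by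
  have h0 : gridCfg (loadedEdge d p) D s (plaqSite d p j, 0) = D (s j) := gridCfg_loadedEdge s j
  have h1 : gridCfg (loadedEdge d p) D s (plaqSite d p j + Pi.single 0 1, 1) = 1 := by
    simp only [gridCfg, edgeCoeff_loadedEdge_dir_one, zero_zsmul, Finset.sum_const_zero,
      map_zero_eq_one_of_map_add hD]
  have h2 : gridCfg (loadedEdge d p) D s (plaqSite d p j + Pi.single 1 1, 0) = 1 := by
    simp only [gridCfg, edgeCoeff_loadedEdge_top, zero_zsmul, Finset.sum_const_zero, map_zero_eq_one_of_map_add hD]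
  have h3 : gridCfg (loadedEdge d p) D s (plaqSite d p j, 1) = 1 := by
    simp only [gridCfg, edgeCoeff_loadedEdge_dir_one, zero_zsmul, Finset.sum_const_zero,
      map_zero_eq_one_of_map_add hD]
  rw [plaquetteHolonomyZd, h0, h1, h2, h3]
  simp

end AnyGroup

/-! The real fundamental character `Re tr : SU(m) → ℝ` is the tree's `Literature.MathematicalPhysics.QuantumLattice.reTr`
(`GaugeGroupsProofs`: a continuous class function, `continuous_reTr`, `reTr_conj`), used BY NAME. -/

/-- THE WITNESS `F = Π_{j<p} Re tr U_{p_j}`: the product of the `p` fundamental plaquette Wilson loops at the test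
plaquettes. [folklore] -/
noncomputable def witnessObs (d p : ℕ) : LGConfig (d + 2) (Matrix.specialUnitaryGroup (Fin (p + 1)) ℂ) → ℝ :=
  fun U => ∏ j : Fin p, plaqObsAt reTr (plaqSite d p j) 0 1 U

/-- `F` IS a product of `p` single-loop observables (`p_j` as the `1 × 1` rectangular walk at `x_j`, tree
`walkHolonomy_rectWalk_one_one`): `F ∈ 𝒫_p`. [folklore] -/
theorem witnessObs_mem_allProdLoopObs (d p : ℕ) :
    witnessObs d p ∈ allProdLoopObs (d + 2) (Matrix.specialUnitaryGroup (Fin (p + 1)) ℂ) p := by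
  refine ⟨(fun _ => reTr, fun j => ⟨plaqSite d p j, rectWalk (plaqSite d p j) 0 1 1 1⟩), ?_⟩
  funext U
  simp only [prodLoopObs, witnessObs, plaqObsAt, wilsonLoopObs, walkHolonomy_rectWalk_one_one]

/-- Finite products of gauge-invariant observables are gauge invariant. [folklore] -/
theorem isZdGaugeInvariant_finset_prod {e : ℕ} {H : Type*} [Group H] {ι : Type*} (t : Finset ι)
    (F : ι → LGConfig e H → ℝ) (h : ∀ i, IsZdGaugeInvariant (F i)) :
    IsZdGaugeInvariant (fun U => ∏ i ∈ t, F i U) := fun g U =>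
  Finset.prod_congr rfl fun i _ => h i g U

/-- Finite products of cylinders are cylinders (on the union of the supports). [folklore] -/
theorem isCylinder_finset_prod {e : ℕ} {H : Type*} {ι : Type*} [DecidableEq (ZdEdge e)] (t : Finset ι)
    (F : ι → LGConfig e H → ℝ) (S : ι → Finset (ZdEdge e)) (h : ∀ i, IsCylinder (F i) (S i)) :
    IsCylinder (fun U => ∏ i ∈ t, F i U) (t.biUnion S) := by
  intro U V hUV
  exact Finset.prod_congr rfl fun i hi => h i fun x hx =>
    hUV x (Finset.mem_coe.2 (Finset.mem_biUnion.2 ⟨i, hi, Finset.mem_coe.1 hx⟩))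

/-- A continuous real function on a compact space is bounded. [folklore] -/
theorem exists_abs_le_of_continuous_compact {X : Type*} [TopologicalSpace X] [CompactSpace X] {F : X → ℝ}
    (hF : Continuous F) : ∃ C, ∀ U, |F U| ≤ C := by
  obtain ⟨C, hC⟩ := (isCompact_range (continuous_abs.comp hF)).bddAbove
  exact ⟨C, fun U => hC ⟨U, rfl⟩⟩

/-- `F` is gauge invariant. [folklore] -/
theorem isZdGaugeInvariant_witnessObs : IsZdGaugeInvariant (witnessObs d p) :=
  isZdGaugeInvariant_finset_prod Finset.univ _ fun j => isZdGaugeInvariant_plaqObsAt reTr_conj (plaqSite d p j) 0 1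

/-- `F` is a cylinder (on the `4p` plaquette edges). [folklore] -/
theorem exists_isCylinder_witnessObs : ∃ S : Finset (ZdEdge (d + 2)), IsCylinder (witnessObs d p) S := by
  classical
  exact ⟨_, isCylinder_finset_prod Finset.univ _ _ fun j => isCylinder_plaqObsAt reTr (plaqSite d p j) 0 1⟩

/-- `F` is continuous. [folklore] -/
theorem continuous_witnessObs : Continuous (witnessObs d p) :=
  continuous_finsetProd Finset.univ fun j _ => continuous_plaqObsAt continuous_reTr (plaqSite d p j) 0 1

/-- `F` is bounded. [folklore] -/
theorem exists_abs_witnessObs_le : ∃ C, ∀ U, |witnessObs d p U| ≤ C :=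
  exists_abs_le_of_continuous_compact continuous_witnessObs

end Concrete

end Summit.QuantumFields.BalabanUV.InfiniteVolume.LoopProductVanishing
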